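import Literature.InformationTheory.QuantumCodes.RotatedSurfaceCodeCrossingPathsZ
import Literature.InformationTheory.QuantumCodes.PlanarCodeCrossingPathsBound
import HarnessLib

/-!
# The Dennis–Kitaev–Landahl–Preskill counting bound for the ROTATED surface code, `H_Z` sector (every `L ≥ 2`): half-faulty
# crossing paths, their number `≤ L·cₙ`, and `Prob[odd row-0 residual] ≤ L·C·r^L/(1-r)` under `cₙ ≤ C νⁿ`, `r = 2ν√(p(1-p))`

Topic `Literature/InformationTheory/QuantumCodes` (venture QEC, rung Q5, row 09; qec-type-09 gen 6, second lift for the `H_Z`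
sector). All PROVED, kernel axioms, no named fact. Verbatim twin of `RotatedSurfaceCodeCrossingPathsBound.lean` (the `H_X`
sector), on top of `RotatedSurfaceCodeCrossingPathsZ.lean` (`IsZCrossing`, `zPathQubits`, `rsc_existsZ_crossing_subset`):

* ★ `rsc_existsZ_crossing_of_oddResidual` — for `L ≥ 2`, if the residual `D(H_Z e) + e` of a MINIMUM-WEIGHT decoder of the
  `H_Z` sector of `RSC(L)` has an odd number of qubits in row `0` (as every non-trivial `X`-logical has — one encoded qubit;
  Summits-side), some rough-to-rough self-avoiding path with `n ≥ L` bonds has at least `n/2` of its qubits in `supp e`;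
* ★ `rsc_sum_bernoulliWeight_oddResidualZ_le` — under independent flips of rate `0 ≤ p ≤ 1/2` and `ToricCode.SAWCountBound C ν`
  with `r = 2ν√(p(1-p)) < 1`: `Σ_{e : odd residual} w_p(e) ≤ L·C·r^L/(1-r)`;
* `rsc_tendsto_sum_oddResidualZ` — hence for `4ν² p(1-p) < 1` these sums tend to `0` along the family `L = i + 1 → ∞`.

## References

* [DennisEtAl2002] E. Dennis, A. Kitaev, A. Landahl, J. Preskill, *Topological quantum memory*, J. Math. Phys. 43 (2002)
  4452–4505, arXiv:quant-ph/0110143, §5.2 (eqs. (e_ineq), (27)–(28)), §5.3 (eqs. (29), (threshold_2d), (fail_2d); planar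
  codes: "This change has no effect on the estimate of the threshold").
* [MadrasSlade1993] N. Madras, G. Slade, *The Self-Avoiding Walk*, Birkhäuser 1993, §1.1 (`cₙ`).
-/

namespace Literature.InformationTheory.QuantumCodes

namespace RotatedSurface

open Finset Matrix Filter Topology
open Literature.Probability.LatticeModels (Site)
open Literature.Probability.RandomPlanarGeometry
open Literature.Probability.RandomPlanarGeometry.SAW.Zd (saws card_saws)

variable {L : ℕ}

/-- `x + y = 0 → x = y` in `ℤ₂`. [folklore] -/
private theorem zmod2_eq_of_add_eq_zeroZ {x y : ZMod 2} (h : x + y = 0) : x = y := by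
  revert x y; decide

/-- ★ **An odd row-`0` residual of a minimum-weight decoder contains a long, half-faulty rough-to-rough self-avoiding path**
(`L ≥ 2`): `n ≥ L` bonds, at least `n/2` of its qubits in `supp e`. [cite: DennisEtAl2002, §5.2 (H ≥ L and eq. (e_ineq)), §5.3] -/
theorem rsc_existsZ_crossing_of_oddResidual (hL : 2 ≤ L) {D : Decoder (Fin (L - 1) × Fin (L + 1) → ZMod 2) (Fin L × Fin L → ZMod 2)}
    (hD : D.IsMinWeight (fun e => HZ L *ᵥ e) {x | HZ L *ᵥ x = 0} hammingNorm) {e : Fin L × Fin L → ZMod 2}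
    (hodd : ∑ j : Fin L, (D (HZ L *ᵥ e) + e) (⟨0, by omega⟩, j) = 1) :
    ∃ (b₀ : Fin L) (n : ℕ) (ω : ℕ → Site 2), ω ∈ saws 2 n ∧ IsZCrossing L b₀ n ω ∧ L ≤ n ∧
      n ≤ 2 * (zPathQubits b₀ n ω ∩ supp e).card := by
  classical
  set e' := D (HZ L *ᵥ e) with he'
  have hc : HZ L *ᵥ (e' + e) = 0 := hD.add_mem e
  obtain ⟨b₀, n, ω, hω, hX, hsub⟩ :=
    rsc_existsZ_crossing_subset (Er := supp (e' + e)) hL hc (fun q hq => by simpa [supp] using hq) hodd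
  refine ⟨b₀, n, ω, hω, hX, le_length_of_isZCrossing hω hX, ?_⟩
  set χ : Fin L × Fin L → ZMod 2 := fun q => if q ∈ zPathQubits b₀ n ω then 1 else 0 with hχ
  have hχ0 : HZ L *ᵥ χ = 0 := HZ_mulVec_zPathQubits hω hX (χ := χ) fun q => rfl
  have hsyn : HZ L *ᵥ (e' + χ) = HZ L *ᵥ e := by
    rw [Matrix.mulVec_add, hχ0, add_zero]
    rw [Matrix.mulVec_add] at hc
    funext i
    exact zmod2_eq_of_add_eq_zeroZ (congrFun hc i)
  have hmin : hammingNorm e' ≤ hammingNorm (e' + χ) := by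
    have := hD.weight_le (e' + χ)
    rwa [hsyn] at this
  calc n = (zPathQubits b₀ n ω).card := (card_zPathQubits hω hX).symm
    _ ≤ 2 * (zPathQubits b₀ n ω ∩ supp e).card := PlanarCode.card_le_two_mul_card_inter_supp (fun q => rfl) hsub hmin

/-- A binary chain is determined by its support. [folklore] -/
private theorem supp_injective_rscZ {V : Type*} [Fintype V] [DecidableEq V] :
    Function.Injective (supp : (V → ZMod 2) → Finset V) := by
  intro e₁ e₂ h
  funext v
  have h1 : v ∈ supp e₁ ↔ v ∈ supp e₂ := by rw [h]
  simp only [supp, Finset.mem_filter, Finset.mem_univ, true_and] at h1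
  have key : ∀ x y : ZMod 2, (x ≠ 0 ↔ y ≠ 0) → x = y := by decide
  exact key _ _ h1

/-- The walk-count constant is non-negative (`c₀ = 1`). [cite: DennisEtAl2002, §5.3 eq. (29)] -/
private theorem nonneg_of_sawCountBound_rscZ {C ν : ℝ} (h : ToricCode.SAWCountBound C ν) : 0 ≤ C := by
  have h0 := h 0
  rw [SAW.count_zero, pow_zero, mul_one, Nat.cast_one] at h0
  linarith

open Classical in
/-- ★ **DKLP's counting bound for the rotated surface code** (`L ≥ 2`, `H_Z` sector, minimum-weight decoder `D`, i.i.d. flips of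
rate `0 ≤ p ≤ 1/2`, `cₙ ≤ C νⁿ`, `r = 2ν√(p(1-p)) < 1`): the total probability of the errors whose residual has an odd number of
row-`0` qubits is at most `Σ_{n ≥ L} L·cₙ·(2√(p(1-p)))ⁿ ≤ L·C·r^L/(1-r)`.
[cite: DennisEtAl2002, §5.2 eqs. (27)–(28), §5.3 eqs. (29), (fail_2d)] -/
theorem rsc_sum_bernoulliWeight_oddResidualZ_le (hL : 2 ≤ L) {C ν : ℝ} (hν : 0 < ν) (hC : ToricCode.SAWCountBound C ν)
    {D : Decoder (Fin (L - 1) × Fin (L + 1) → ZMod 2) (Fin L × Fin L → ZMod 2)}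
    (hD : D.IsMinWeight (fun e => HZ L *ᵥ e) {x | HZ L *ᵥ x = 0} hammingNorm)
    {p : ℝ} (hp0 : 0 ≤ p) (hp : p ≤ 1 / 2) (hr1 : 2 * ν * Real.sqrt (p * (1 - p)) < 1) :
    ∑ e ∈ univ.filter (fun e : Fin L × Fin L → ZMod 2 =>
        ∑ j : Fin L, (D (HZ L *ᵥ e) + e) (⟨0, by omega⟩, j) = 1), bernoulliWeight p (supp e) ≤
      (L : ℝ) * C * (2 * ν * Real.sqrt (p * (1 - p))) ^ L / (1 - 2 * ν * Real.sqrt (p * (1 - p))) := by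
  classical
  set s := Real.sqrt (p * (1 - p)) with hs
  set r := 2 * ν * s with hr
  have hs0 : 0 ≤ s := Real.sqrt_nonneg _
  have hr0 : 0 ≤ r := by rw [hr]; positivity
  have h1r : 0 < 1 - r := by linarith
  have hC0 : 0 ≤ C := nonneg_of_sawCountBound_rscZ hC
  set F := univ.filter (fun e : Fin L × Fin L → ZMod 2 =>
    ∑ j : Fin L, (D (HZ L *ᵥ e) + e) (⟨0, by omega⟩, j) = 1) with hF
  have hsum : ∑ e ∈ F, bernoulliWeight p (supp e) = ∑ E ∈ F.image supp, bernoulliWeight p E :=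
    (Finset.sum_image fun e₁ _ e₂ _ h => supp_injective_rscZ h).symm
  rw [hsum]
  set M := Fintype.card (Fin L × Fin L) with hM
  set I : Finset (Σ _ : ℕ, Fin L × (ℕ → Site 2)) :=
    (Finset.Ico L (M + 1)).sigma fun n => (univ : Finset (Fin L)) ×ˢ saws 2 n with hI
  set Ps : Finset (Σ _ : ℕ, Fin L × (ℕ → Site 2)) := I.filter (fun x => IsZCrossing L x.2.1 x.1 x.2.2) with hPs
  set T : (Σ _ : ℕ, Fin L × (ℕ → Site 2)) → Finset (Fin L × Fin L) := fun x => zPathQubits x.2.1 x.1 x.2.2 with hT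
  have hmem : ∀ x ∈ Ps, x.2.2 ∈ saws 2 x.1 ∧ IsZCrossing L x.2.1 x.1 x.2.2 := by
    intro x hx
    rw [hPs, Finset.mem_filter, hI, Finset.mem_sigma, Finset.mem_product] at hx
    exact ⟨hx.1.2.2, hx.2⟩
  have hcard : ∀ x ∈ Ps, (T x).card = x.1 := fun x hx => card_zPathQubits (hmem x hx).1 (hmem x hx).2
  have hcover : ∀ E ∈ F.image supp, ∃ x ∈ Ps, (T x).card ≤ 2 * (T x ∩ E).card := by
    intro E hE
    obtain ⟨e, he, rfl⟩ := Finset.mem_image.1 hE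
    have hodd := (Finset.mem_filter.1 he).2
    obtain ⟨b₀, n, ω, hω, hX, hLn, hhalf⟩ := rsc_existsZ_crossing_of_oddResidual hL hD hodd
    have hnM : n ≤ M := by
      rw [← card_zPathQubits hω hX]
      exact Finset.card_le_univ _
    refine ⟨⟨n, b₀, ω⟩, ?_, ?_⟩
    · rw [hPs, Finset.mem_filter, hI, Finset.mem_sigma, Finset.mem_product, Finset.mem_Ico]
      exact ⟨⟨⟨hLn, Nat.lt_succ_of_le hnM⟩, Finset.mem_univ _, hω⟩, hX⟩
    · show (zPathQubits b₀ n ω).card ≤ 2 * (zPathQubits b₀ n ω ∩ supp e).card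
      rw [card_zPathQubits hω hX]
      exact hhalf
  have h1 := sum_bernoulliWeight_le_of_cover hp0 hp Ps T (F.image supp) hcover
  have h2 : ∑ x ∈ Ps, (2 * s) ^ (T x).card ≤ ∑ x ∈ I, (2 * s) ^ x.1 :=
    calc ∑ x ∈ Ps, (2 * s) ^ (T x).card = ∑ x ∈ Ps, (2 * s) ^ x.1 :=
          Finset.sum_congr rfl fun x hx => by rw [hcard x hx]
      _ ≤ ∑ x ∈ I, (2 * s) ^ x.1 :=
          Finset.sum_le_sum_of_subset_of_nonneg (Finset.filter_subset _ _) fun _ _ _ => pow_nonneg (by positivity) _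
  have h3 : ∑ x ∈ I, (2 * s) ^ x.1 = ∑ n ∈ Finset.Ico L (M + 1), (L : ℝ) * ((saws 2 n).card : ℝ) * (2 * s) ^ n := by
    rw [hI, Finset.sum_sigma]
    refine Finset.sum_congr rfl fun n _ => ?_
    show ∑ y ∈ (univ : Finset (Fin L)) ×ˢ saws 2 n, (2 * s) ^ n = _
    rw [Finset.sum_const, Finset.card_product, Finset.card_univ, Fintype.card_fin, nsmul_eq_mul]
    push_cast
    ring
  have h4 : ∀ n ∈ Finset.Ico L (M + 1), (L : ℝ) * ((saws 2 n).card : ℝ) * (2 * s) ^ n ≤ (L : ℝ) * C * r ^ n := by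
    intro n _
    have hc : ((saws 2 n).card : ℝ) ≤ C * ν ^ n := by
      rw [card_saws, SAW.Zd.count_two]
      exact hC n
    have hk : (0 : ℝ) ≤ (L : ℝ) := by positivity
    calc (L : ℝ) * ((saws 2 n).card : ℝ) * (2 * s) ^ n ≤ (L : ℝ) * (C * ν ^ n) * (2 * s) ^ n :=
          mul_le_mul_of_nonneg_right (mul_le_mul_of_nonneg_left hc hk) (pow_nonneg (by positivity) _)
      _ = (L : ℝ) * C * r ^ n := by
          rw [hr, mul_pow, mul_pow]
          ring
  have hgeom := geom_tail_le hr0 hr1 L (M + 1)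
  calc ∑ E ∈ F.image supp, bernoulliWeight p E
      ≤ ∑ x ∈ Ps, (2 * s) ^ (T x).card := h1
    _ ≤ ∑ x ∈ I, (2 * s) ^ x.1 := h2
    _ = ∑ n ∈ Finset.Ico L (M + 1), (L : ℝ) * ((saws 2 n).card : ℝ) * (2 * s) ^ n := h3
    _ ≤ ∑ n ∈ Finset.Ico L (M + 1), (L : ℝ) * C * r ^ n := Finset.sum_le_sum h4
    _ = (L : ℝ) * C * ∑ n ∈ Finset.Ico L (M + 1), r ^ n := by rw [Finset.mul_sum]
    _ ≤ (L : ℝ) * C * (r ^ L / (1 - r)) := mul_le_mul_of_nonneg_left hgeom (by positivity)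
    _ = (L : ℝ) * C * r ^ L / (1 - r) := by ring

open Classical in
/-- **The rotated counting bound tends to zero below `p₀(ν)`** along the family `L = i + 1`: under `cₙ ≤ C νⁿ`, for every
family of minimum-weight decoders of the `H_Z` sectors and every `0 ≤ p ≤ 1/2` with `4ν² p(1-p) < 1`.
[cite: DennisEtAl2002, §5.3 eqs. (threshold_2d), (fail_2d)] -/
theorem rsc_tendsto_sum_oddResidualZ {C ν : ℝ} (hν : 0 < ν) (hC : ToricCode.SAWCountBound C ν)
    (D : ∀ i : ℕ, Decoder (Fin (i + 1 - 1) × Fin (i + 1 + 1) → ZMod 2) (Fin (i + 1) × Fin (i + 1) → ZMod 2))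
    (hD : ∀ i, (D i).IsMinWeight (fun e => HZ (i + 1) *ᵥ e) {x | HZ (i + 1) *ᵥ x = 0} hammingNorm)
    {p : ℝ} (hp0 : 0 ≤ p) (hp : p ≤ 1 / 2) (h4 : 4 * ν ^ 2 * (p * (1 - p)) < 1) :
    Tendsto (fun i => ∑ e ∈ univ.filter (fun e : Fin (i + 1) × Fin (i + 1) → ZMod 2 =>
        ∑ j : Fin (i + 1), (D i (HZ (i + 1) *ᵥ e) + e) (⟨0, by omega⟩, j) = 1), bernoulliWeight p (supp e))
      atTop (𝓝 0) := by
  set s := Real.sqrt (p * (1 - p)) with hs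
  set r := 2 * ν * s with hr
  have hs0 : 0 ≤ s := Real.sqrt_nonneg _
  have hr0 : 0 ≤ r := by rw [hr]; positivity
  have hpp : 0 ≤ p * (1 - p) := mul_nonneg hp0 (by linarith)
  have hr1 : r < 1 := by
    have hsq : r ^ 2 = 4 * ν ^ 2 * (p * (1 - p)) := by
      rw [hr, mul_pow, mul_pow, hs, Real.sq_sqrt hpp]
      ring
    have h : r ^ 2 < 1 := by rw [hsq]; exact h4
    have := (sq_lt_one_iff_abs_lt_one r).1 h
    rwa [abs_of_nonneg hr0] at this
  have h1r : 0 < 1 - r := by linarith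
  have hC0 : 0 ≤ C := nonneg_of_sawCountBound_rscZ hC
  have hbound : ∀ i : ℕ, 1 ≤ i → (∑ e ∈ univ.filter (fun e : Fin (i + 1) × Fin (i + 1) → ZMod 2 =>
        ∑ j : Fin (i + 1), (D i (HZ (i + 1) *ᵥ e) + e) (⟨0, by omega⟩, j) = 1), bernoulliWeight p (supp e)) ≤
      ((i + 1 : ℕ) : ℝ) * C * r ^ (i + 1) / (1 - r) :=
    fun i hi => rsc_sum_bernoulliWeight_oddResidualZ_le (L := i + 1) (by omega) hν hC (hD i) hp0 hp hr1
  have hnonneg : ∀ i : ℕ, 0 ≤ ∑ e ∈ univ.filter (fun e : Fin (i + 1) × Fin (i + 1) → ZMod 2 =>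
        ∑ j : Fin (i + 1), (D i (HZ (i + 1) *ᵥ e) + e) (⟨0, by omega⟩, j) = 1), bernoulliWeight p (supp e) :=
    fun i => Finset.sum_nonneg fun e _ => bernoulliWeight_nonneg hp0 (by linarith) _
  have hlim : Tendsto (fun i : ℕ => ((i + 1 : ℕ) : ℝ) * C * r ^ (i + 1) / (1 - r)) atTop (𝓝 0) := by
    have h0 := tendsto_pow_const_mul_const_pow_of_abs_lt_one 1 (show |r| < 1 by rwa [abs_of_nonneg hr0])
    have h1 : Tendsto (fun i : ℕ => ((i + 1 : ℕ) : ℝ) ^ 1 * r ^ (i + 1)) atTop (𝓝 0) :=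
      (Filter.tendsto_add_atTop_iff_nat 1).2 h0
    have h2 := h1.const_mul (C / (1 - r))
    rw [mul_zero] at h2
    refine h2.congr fun i => ?_
    have h1r0 : 1 - r ≠ 0 := h1r.ne'
    field_simp
  refine squeeze_zero' (Filter.Eventually.of_forall hnonneg) ?_ hlim
  rw [Filter.eventually_atTop]
  exact ⟨1, fun i hi => hbound i hi⟩

end RotatedSurface

end Literature.InformationTheory.QuantumCodes
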